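import Literature.MathematicalPhysics.QuantumFieldTheory.BalabanImbrieJaffe1984to88.BIJ88WalkTermCounting309

/-!
# `BalabanImbrieJaffe1984to88.BIJ88WalkTermBound309` — T. Bałaban, J. Imbrie, A. Jaffe, *Effective action and cluster properties of the
abelian Higgs model*, Commun. Math. Phys. **114** (1988) 257–315 [BalabanImbrieJaffe1988]: p. 307 [PDF 51] L2–13 and p. 309 [PDF 53] L19–28
((5.14.4): *"g₃(H_β, X_β) is bounded by e^{−r(e_k)(|H_β| + β′|X_β∖X_{H_β}|)}"*, *"The proof of this estimate is similar to the one for g₂"*) —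
**ONE TERM OF THE MASTER BOUND UNDER BOUNDED LETTERS**: the summand of `BIJ88LocatedActivityBound309.abs_actIn_le_master` at a vertex structure
`σ`, a grouping `P`, end data `E` and a slot assignment `g` of the legs — (train-end sizes) × (slot letters of the located slots) × (Gaussian shells
of the hit χ-slots) — is at most `K₁^{N₀} · Aχ^{G} · AV^{G} · θ^{|H|} · (ε θ^{β′N₀})` when `|X″| ≤ N₀`, the located slots number `≤ G`, every
label of `H` is located in `X″` (so the `t`-derivative counts of the located slots add up to `|H|`), and the letters are BOUNDED as in
`BIJ88WalkTermCounting309.slots_mul_shells_le` / `ends_le`: the leg that every nonempty product of trains has (`trainLegs_nonempty`) lands on a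
located slot (the assignment ranges over located slots on legs) and pays `ε θ^{β′N₀}` — through its Gaussian shell if a χ-slot, through its
letter if a `V`-slot; the `t`-derivatives pay `θ^{m}` slot by slot (`e_k ≤ θ` on χ-slots via the shell's `(t e_k)^M`, `θV ≤ θ` on `V`-slots).
* `term_le` — the bound, over abstract slot/site types (it is letter bookkeeping; no Gaussian input).

statement-level skeleton of published theorems with citation tags; proofs where landed; nothing here is a claim about the Yang–Mills mass gap

PDF held: `paper:balaban1988-cmp114-bij-abelian-higgs-effective-action` (journal page = PDF page + 256); pages re-read this session as text:
PDF 51 (p. 307) L2–23, PDF 53 (p. 309) L10–28.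

CITATION HEADER (lean-in-tree rule).  Part of the lit-balaban TYPED SKELETON (HOME `run/shared/lean/pub/lit-balaban/`), Phase 2, seat p36
(gen 22, unit `lit-balaban-p36`); row **C2.Eq5.14.3-5.14.4** (member: §f assembly, per-term step E4e of the bounded-size instance) of
`HOME/lit-balaban-r16/ROWS-C2-part2.md` (owner r16, referee ref-5).  Theorem-only; no definitions, no `Prop` facts; axioms standard.
HONEST SCOPE.  Bookkeeping of LETTERS: which printed smallness each letter stands for is recorded in `BIJ88WalkTermCounting309` §4 and in the
instance file `BIJ88Ineq5144BoundedSize309`; the per-cube decay of print's (5.14.4) for LARGE `|X″|` (walk decay across nonexceptional cubes,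
*"as in [9]"*) is NOT captured by bounded letters — this is the bounded-size regime only.  NOT summit progress; NOT continuum; NOT Clay.
-/

namespace Literature.MathematicalPhysics.QuantumFieldTheory.BalabanImbrieJaffe1984to88.BIJ88WalkTermBound309

open Finset
open scoped BigOperators
open Literature.Probability.LatticeModels (setPartitions)
open BIJ88PairingAllOrders5133 (smallParts)
open BIJ88TrainsDsetExpansion306 (trainLegs trainSite)
open BIJ88WalkTermCounting309 (length_toList_le toList_length_pos trainLegs_nonempty card_trainLegs_le prod_attach_filter
  slots_mul_shells_le ends_le)

/-- **ONE TERM OF THE MASTER BOUND UNDER BOUNDED LETTERS** (see the module docstring): for `σ ∈ smallParts X″`, `P ∈ setPartitions σ`, end data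
`E`, and an assignment `g` of the legs to located slots,
`(Π_k end_k) · (Π_{τ located} A_τ(m_τ,n_τ) Π_j w_τ(q_j)) · Π_{b hit} 2e^{−a_b(a_b−2ΛF/m)/(2Λ²/m)} ≤ K₁^{N₀} · (Aχ^{G} AV^{G} θ^{|H|} (ε θ^{β′N₀}))`.
[cite: BalabanImbrieJaffe1988, (5.14.4) p.309 L19–28; §5.13 p.307 L2–13] -/
theorem term_le {I : Type} [DecidableEq I] {β υ : Type} [Fintype β] [Fintype υ] [DecidableEq β] [DecidableEq υ]
    (cube' : β ⊕ υ → I) (X'' : Finset I) {Sx : Type} [Fintype Sx] [DecidableEq Sx]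
    {Sl : Type*} (γ' : Sl → β ⊕ υ) (H : Finset Sl) (hHloc : ∀ j ∈ H, cube' (γ' j) ∈ X'') {M N₀ G : ℕ} (hHM : H.card ≤ M)
    (hX : X''.card ≤ N₀) (hXne : X''.Nonempty) (hG : (univ.filter fun τ => cube' τ ∈ X'').card ≤ G)
    {σ : Finset (Finset I)} (hσ : σ ∈ smallParts X'') {P : Finset (Finset (Finset I))} (hP : P ∈ setPartitions σ)
    (E : Fin P.toList.length → Sx ⊕ (Sx × Sx)) (τ₀ : β ⊕ υ) {g : Fin P.toList.length ×ₗ Fin 2 → β ⊕ υ}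
    (hg : g ∈ Fintype.piFinset fun j => if j ∈ trainLegs E then univ.filter (fun τ => cube' τ ∈ X'') else {τ₀})
    {κc : Finset (Finset I) → Sx → Sx → ℝ} {Fq : Sx → ℝ} {K₁ F₀ : ℝ} (hK1 : 1 ≤ K₁) (hκ0 : ∀ cg x y, 0 ≤ κc cg x y)
    (hκ1 : ∀ cg x y, κc cg x y ≤ K₁) (hFq0 : ∀ y, 0 ≤ Fq y) (hFq1 : ∀ y, Fq y ≤ F₀) (hvol : (Fintype.card Sx : ℝ) * F₀ ≤ 1)
    {A : β ⊕ υ → ℕ → ℕ → ℝ} (hA : ∀ τ m n, 0 ≤ A τ m n) {w : β ⊕ υ → Sx → ℝ} (hw : ∀ τ x, 0 ≤ w τ x) (hw1 : ∀ τ x, w τ x ≤ 1)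
    {t ek θ θS θV Aχ AV ε β' : ℝ} (ht0 : 0 < t) (ht1 : t ≤ 1) (hek0 : 0 ≤ ek) (hekθ : ek ≤ θ) (hθ1 : θ ≤ 1)
    (hθS0 : 0 ≤ θS) (hθS1 : θS ≤ 1) (hθV0 : 0 ≤ θV) (hθVθ : θV ≤ θ) (hAχ : 1 ≤ Aχ) (hAV : 1 ≤ AV) (hε : 0 ≤ ε)
    (hSε : θS ≤ ε * θ ^ (β' * (N₀ : ℝ))) (hVε : θV ≤ ε * θ ^ (β' * (N₀ : ℝ)))
    (hAχ' : ∀ b m n, m ≤ M → n ≤ 2 * N₀ → t ^ m * A (Sum.inl b) m n ≤ Aχ) (hA10 : ∀ b, A (Sum.inl b) 0 0 ≤ 1)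
    (hAV' : ∀ Y m n, m ≤ M → n ≤ 2 * N₀ → A (Sum.inr Y) m n ≤ AV * θV ^ (m + n))
    {a : β → ℝ} {Λ F mc : ℝ}
    (hS : ∀ b, cube' (Sum.inl b) ∈ X'' → 2 * Real.exp (-(a b * (a b - 2 * (Λ * F / mc)) / (2 * (Λ ^ 2 / mc)))) ≤ (t * ek) ^ M * θS) :
    (∏ k, Sum.elim (fun x => ∑ y, κc (P.toList.get k) x y * Fq y) (fun xy => (1 / 2 : ℝ) * κc (P.toList.get k) xy.1 xy.2) (E k)) *
      (∏ τ ∈ univ.filter (fun τ => cube' τ ∈ X''),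
        (A τ (H.filter fun j => γ' j = τ).card ((trainLegs E).filter fun j => g j = τ).card *
          ∏ j ∈ (trainLegs E).filter (fun j => g j = τ), w τ (trainSite E j))) *
      ∏ b ∈ (univ.filter fun b : β => cube' (Sum.inl b) ∈ X'').attach.filter (fun b =>
          (H.filter fun j => γ' j = Sum.inl b.1).card ≠ 0 ∨ ((trainLegs E).filter fun j => g j = Sum.inl b.1).card ≠ 0),
        2 * Real.exp (-(a b.1 * (a b.1 - 2 * (Λ * F / mc)) / (2 * (Λ ^ 2 / mc)))) ≤
    K₁ ^ N₀ * (Aχ ^ G * AV ^ G * θ ^ H.card * (ε * θ ^ (β' * (N₀ : ℝ)))) := by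
  have hθ0 : 0 ≤ θ := hek0.trans hekθ
  have hn : P.toList.length ≤ N₀ := (length_toList_le hσ hP).trans hX
  have hends := ends_le hn (κc := fun k => κc (P.toList.get k)) hK1 (fun k => hκ0 _) (fun k => hκ1 _) hFq0 hFq1 hvol E
  -- the located slots split into χ-slots and `V`-slots
  set Bloc := univ.filter fun b : β => cube' (Sum.inl b) ∈ X'' with hBloc
  set Yloc := univ.filter fun Y : υ => cube' (Sum.inr Y) ∈ X'' with hYloc
  have hT : (univ.filter fun τ : β ⊕ υ => cube' τ ∈ X'') = Bloc.disjSum Yloc := by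
    ext τ; rcases τ with b | Y <;> simp [hBloc, hYloc, mem_disjSum]
  have hBG : Bloc.card ≤ G := by
    refine le_trans ?_ hG; rw [hT, card_disjSum]; exact Nat.le_add_right _ _
  have hYG : Yloc.card ≤ G := by
    refine le_trans ?_ hG; rw [hT, card_disjSum]; exact Nat.le_add_left _ _
  -- the `t`-derivative counts of the located slots add up to `|H|`
  have hsum : ∑ τ ∈ Bloc.disjSum Yloc, (H.filter fun j => γ' j = τ).card = H.card := by
    rw [← hT]
    exact (card_eq_sum_card_fiberwise (f := γ') (s := H) (t := univ.filter fun τ : β ⊕ υ => cube' τ ∈ X'')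
      fun j hj => mem_coe.2 (mem_filter.2 ⟨mem_univ _, hHloc j (mem_coe.1 hj)⟩)).symm
  -- counts are bounded: `m_τ ≤ M`, `n_τ ≤ 2N₀`
  have hmM : ∀ τ, (H.filter fun j => γ' j = τ).card ≤ M := fun τ => (card_filter_le _ _).trans hHM
  have hnN : ∀ τ, ((trainLegs E).filter fun j => g j = τ).card ≤ 2 * N₀ := fun τ =>
    ((card_filter_le _ _).trans (card_trainLegs_le E)).trans (Nat.mul_le_mul_left 2 hn)
  have hwprod : ∀ τ, ∏ j ∈ (trainLegs E).filter (fun j => g j = τ), w τ (trainSite E j) ≤ 1 := fun τ =>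
    prod_le_one (fun j _ => hw _ _) fun j _ => hw1 _ _
  have hwprod0 : ∀ τ, 0 ≤ ∏ j ∈ (trainLegs E).filter (fun j => g j = τ), w τ (trainSite E j) := fun τ =>
    prod_nonneg fun j _ => hw _ _
  -- the distinguished leg
  obtain ⟨js, hjs⟩ := trainLegs_nonempty (toList_length_pos hXne hσ hP) E
  have hτs : g js ∈ Bloc.disjSum Yloc := by
    have := Fintype.mem_piFinset.1 hg js
    rwa [if_pos hjs, hT] at this
  have hnτs : ((trainLegs E).filter fun j => g j = g js).card ≠ 0 :=
    card_ne_zero.2 ⟨js, mem_filter.2 ⟨hjs, rfl⟩⟩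
  -- the slot bookkeeping
  have key := slots_mul_shells_le Bloc Yloc (fun τ => (H.filter fun j => γ' j = τ).card)
    (fun τ => ((trainLegs E).filter fun j => g j = τ).card)
    (fun τ => A τ (H.filter fun j => γ' j = τ).card ((trainLegs E).filter fun j => g j = τ).card *
      ∏ j ∈ (trainLegs E).filter (fun j => g j = τ), w τ (trainSite E j))
    (fun b => 2 * Real.exp (-(a b * (a b - 2 * (Λ * F / mc)) / (2 * (Λ ^ 2 / mc)))))
    ht0 ht1 hek0 hekθ hθ1 hθS0 hθS1 hθV0 hθVθ hAχ hAV hε hSε hVε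
    (fun τ => mul_nonneg (hA _ _ _) (hwprod0 τ))
    (fun b _ hh => by
      rw [← mul_assoc]
      exact (mul_le_of_le_one_right (mul_nonneg (pow_nonneg ht0.le _) (hA _ _ _)) (hwprod _)).trans
        (hAχ' b _ _ (hmM _) (hnN _) ))
    (fun b _ hm0 hn0 => by
      simp only [hm0, hn0]
      exact (mul_le_of_le_one_right (hA _ _ _) (hwprod _)).trans (hA10 b))
    (fun Y _ => (mul_le_of_le_one_right (hA _ _ _) (hwprod _)).trans (hAV' Y _ _ (hmM _) (hnN _)))
    (fun b _ => by positivity) (fun b hb => hS b (mem_filter.1 hb).2) hmM (g js) hτs hnτs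
  rw [hsum] at key
  -- the hit-set product as a plain filtered product
  have hSH : ∏ b ∈ Bloc.attach.filter (fun b =>
        (H.filter fun j => γ' j = Sum.inl b.1).card ≠ 0 ∨ ((trainLegs E).filter fun j => g j = Sum.inl b.1).card ≠ 0),
        2 * Real.exp (-(a b.1 * (a b.1 - 2 * (Λ * F / mc)) / (2 * (Λ ^ 2 / mc)))) =
      ∏ b ∈ Bloc.filter (fun b =>
        (H.filter fun j => γ' j = Sum.inl b).card ≠ 0 ∨ ((trainLegs E).filter fun j => g j = Sum.inl b).card ≠ 0),
        2 * Real.exp (-(a b * (a b - 2 * (Λ * F / mc)) / (2 * (Λ ^ 2 / mc)))) :=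
    prod_attach_filter Bloc
      (fun b => (H.filter fun j => γ' j = Sum.inl b).card ≠ 0 ∨ ((trainLegs E).filter fun j => g j = Sum.inl b).card ≠ 0)
      (fun b => 2 * Real.exp (-(a b * (a b - 2 * (Λ * F / mc)) / (2 * (Λ ^ 2 / mc)))))
  rw [mul_assoc, hSH, hT]
  refine mul_le_mul hends (key.trans ?_) (mul_nonneg (prod_nonneg fun τ _ => mul_nonneg (hA _ _ _) (hwprod0 τ))
    (prod_nonneg fun b _ => by positivity)) (pow_nonneg (zero_le_one.trans hK1) _)
  have hsmall0 : 0 ≤ ε * θ ^ (β' * (N₀ : ℝ)) := mul_nonneg hε (Real.rpow_nonneg hθ0 _)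
  exact mul_le_mul_of_nonneg_right (mul_le_mul_of_nonneg_right
    (mul_le_mul (pow_le_pow_right₀ hAχ hBG) (pow_le_pow_right₀ hAV hYG) (pow_nonneg (zero_le_one.trans hAV) _)
      (pow_nonneg (zero_le_one.trans hAχ) _)) (pow_nonneg hθ0 _)) hsmall0

end Literature.MathematicalPhysics.QuantumFieldTheory.BalabanImbrieJaffe1984to88.BIJ88WalkTermBound309
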